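import Summits.Ventures.PercRepro.ProfilePointedAvoidRow

/-!
# PercRepro — TWO REGIMES OF CONJECTURE (D) AND OF (Ĉ): THE STEP `out_k ≤ out_{k+1}` SUFFICES FOR (Ĉ) IN THE `p`-GIRTH
REGIME, AND (D) HOLDS WHEN EVERY `(k+1)`-SET AVOIDING `p` IS INDEPENDENT (p10, gen 25)

* `pointedRow_level_of_outCount_le_of_indep_succ_mem` — in the `p`-girth regime (every `(k+1)`-subset THROUGH `p`
  independent) the mere STEP `out_k ≤ out_{k+1}` gives (Ĉ) at `(M, p, k)` (weaker hypothesis than (D): with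
  `(N − k)·in_k ≤ k·in_{k+1}` from ProfilePointedAvoidRow, `(N − k − 1)·in_k + k·out_k ≤ k·in_{k+1} + k·out_{k+1}`).
* `insert_mem_biIndepSets_of_indep_succ_notMem`, `avoidRow_level_of_indep_succ_notMem` — **(D) holds at level `k`
  whenever every `(k+1)`-subset AVOIDING `p` is independent** (unconditional): a `p`-avoiding bi-independent `k`-set
  extends by every element `e ≠ p` outside it, so it has at least `N − k − 1` up-neighbours avoiding `p`, while a
  `p`-avoiding `(k+1)`-set has at most `k + 1` down-neighbours — `(N − k − 1)·out_k ≤ (k + 1)·out_{k+1}`.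
* `avoidRow_level_of_indep_succ` — in particular (D) at every level `k` at which all `(k+1)`-subsets are independent.

Nothing here asserts (D) or (Ĉ).
-/

open scoped Matroid

namespace PercRepro.Cogirth

open Finset ThmH Skew

variable {α : Type} [DecidableEq α] {M : Matroid α} [M.Finite]

/-- **THE STEP `out_k ≤ out_{k+1}` GIVES (Ĉ) IN THE `p`-GIRTH REGIME** (unconditional implication). -/
theorem pointedRow_level_of_outCount_le_of_indep_succ_mem {k : ℕ} (hk : 2 * k + 2 ≤ (gr M).card) {p : α}
    (hp : p ∈ gr M) (h1 : ∀ X ⊆ gr M, p ∈ X → X.card = k + 1 → rk M X = X.card)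
    (hstep : outCount M k p ≤ outCount M (k + 1) p) :
    ((gr M).card - k - 1) * (biIndepSets M k).card ≤
      k * (biIndepSets M (k + 1)).card + ((gr M).card - 2 * k - 1) * extCount M k p := by
  rw [extCount_eq_outCount_of_indep_succ_mem hp h1, ← inCount_add_outCount M k p, ← inCount_add_outCount M (k + 1) p]
  have hI := inCount_mul_le_of_indep_succ_mem (M := M) (p := p) h1
  obtain ⟨m, hm⟩ := Nat.exists_eq_add_of_le hk
  rw [hm] at hI ⊢
  rw [show 2 * k + 2 + m - k = k + 2 + m by omega] at hI
  rw [show 2 * k + 2 + m - k - 1 = k + 1 + m by omega, show 2 * k + 2 + m - 2 * k - 1 = m + 1 by omega]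
  generalize inCount M k p = a at hI ⊢
  generalize outCount M k p = b at hI hstep ⊢
  generalize inCount M (k + 1) p = a' at hI ⊢
  generalize outCount M (k + 1) p = b' at hstep ⊢
  apply Nat.le_of_mul_le_mul_left (c := k + 2 + m) _ (by omega)
  have hI' := Nat.mul_le_mul_left (k + 1 + m) hI
  have ha2 : (k + 1 + m) * (a' * k) ≤ (k + 2 + m) * (a' * k) := Nat.mul_le_mul_right _ (by omega)
  have hb2 : (k + 2 + m) * k * b ≤ (k + 2 + m) * k * b' := Nat.mul_le_mul_left _ hstep
  nlinarith [hI', ha2, hb2, Nat.zero_le b, Nat.zero_le k, Nat.zero_le m]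

/-- If every `(k+1)`-subset avoiding `p` is independent, a `p`-avoiding bi-independent `k`-set extends by every element
`e ≠ p` outside it. -/
theorem insert_mem_biIndepSets_of_indep_succ_notMem {k : ℕ} {p : α}
    (h1 : ∀ X ⊆ gr M, p ∉ X → X.card = k + 1 → rk M X = X.card)
    {X : Finset α} (hX : X ∈ biIndepSets M k) (hpX : p ∉ X) {e : α} (he : e ∈ gr M) (heX : e ∉ X) (hep : e ≠ p) :
    insert e X ∈ biIndepSets M (k + 1) := by
  rw [mem_biIndepSets] at hX ⊢
  obtain ⟨hXg, hXc, -, hXd⟩ := hX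
  have hsub : insert e X ⊆ gr M := insert_subset he hXg
  have hcard : (insert e X).card = k + 1 := by rw [card_insert_of_notMem heX, hXc]
  have hpins : p ∉ insert e X := by
    rw [mem_insert, not_or]
    exact ⟨fun h => hep h.symm, hpX⟩
  refine ⟨hsub, hcard, h1 _ hsub hpins hcard, ?_⟩
  exact rk_eq_card_of_subset_of_rk_eq_card (sdiff_subset_sdiff (subset_refl _) (subset_insert e X)) hXd

/-- A `p`-avoiding bi-independent `k`-set has at least `N − k − 1` up-neighbours avoiding `p` when every `(k+1)`-subset
avoiding `p` is independent. -/
theorem le_card_bipartiteAbove_out_of_indep_succ_notMem {k : ℕ} {p : α} (hp : p ∈ gr M)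
    (h1 : ∀ X ⊆ gr M, p ∉ X → X.card = k + 1 → rk M X = X.card)
    {X : Finset α} (hX : X ∈ biIndepSets M k) (hpX : p ∉ X) :
    (gr M).card - k - 1 ≤ (bipartiteAbove (· ⊆ ·) ((biIndepSets M (k + 1)).filter (fun X' => p ∉ X')) X).card := by
  have hXg := (mem_biIndepSets.1 hX).1
  have hXc := (mem_biIndepSets.1 hX).2.1
  have hsub : ((gr M \ X).erase p).image (fun e => insert e X) ⊆
      bipartiteAbove (· ⊆ ·) ((biIndepSets M (k + 1)).filter (fun X' => p ∉ X')) X := by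
    intro Y hY
    rw [mem_image] at hY
    obtain ⟨e, he, rfl⟩ := hY
    rw [mem_erase, mem_sdiff] at he
    rw [mem_bipartiteAbove, mem_filter]
    refine ⟨⟨insert_mem_biIndepSets_of_indep_succ_notMem h1 hX hpX he.2.1 he.2.2 he.1, ?_⟩, subset_insert e X⟩
    rw [mem_insert, not_or]
    exact ⟨fun h => he.1 h.symm, hpX⟩
  have hinj : (((gr M \ X).erase p).image (fun e => insert e X)).card = ((gr M \ X).erase p).card := by
    apply card_image_of_injOn
    intro e he e' he' hee'
    simp only [coe_erase, coe_sdiff, Set.mem_sdiff, mem_coe, Set.mem_singleton_iff] at he he'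
    exact (insert_inj he.1.2).1 hee'
  have hp' : p ∈ gr M \ X := mem_sdiff.2 ⟨hp, hpX⟩
  have := card_le_card hsub
  rw [hinj, card_erase_of_mem hp', card_sdiff_of_subset hXg, hXc] at this
  exact this

/-- **(D) HOLDS AT LEVEL `k` WHENEVER EVERY `(k+1)`-SUBSET AVOIDING `p` IS INDEPENDENT** (unconditional):
`(N − k − 1)·out_k ≤ (k + 1)·out_{k+1}`. -/
theorem avoidRow_level_of_indep_succ_notMem {k : ℕ} {p : α} (hp : p ∈ gr M)
    (h1 : ∀ X ⊆ gr M, p ∉ X → X.card = k + 1 → rk M X = X.card) :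
    ((gr M).card - k - 1) * outCount M k p ≤ (k + 1) * outCount M (k + 1) p := by
  unfold outCount
  rw [mul_comm, mul_comm (k + 1)]
  apply card_mul_le_card_mul (· ⊆ ·)
  · intro X hX
    rw [mem_filter] at hX
    exact le_card_bipartiteAbove_out_of_indep_succ_notMem hp h1 hX.1 hX.2
  · intro X' hX'
    rw [mem_filter] at hX'
    exact card_bipartiteBelow_out_le hX'.1

/-- (D) at every level `k` at which all `(k+1)`-subsets are independent. -/
theorem avoidRow_level_of_indep_succ {k : ℕ} {p : α} (hp : p ∈ gr M)
    (h1 : ∀ X ⊆ gr M, X.card = k + 1 → rk M X = X.card) :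
    ((gr M).card - k - 1) * outCount M k p ≤ (k + 1) * outCount M (k + 1) p :=
  avoidRow_level_of_indep_succ_notMem hp (fun X hX _ hXc => h1 X hX hXc)

end PercRepro.Cogirth
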